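/-
HODGE LADDER — STAGE 4: the OPEN CONTENT of the `@[conjecture]` targets, delimited in the kernel (vacuity audit of the
stage-4 typed entries, literature seat hodge-director-lit-stage4, gen 9).  Theorems only: no definition, no named
fact, no new target.  Sibling of `CorCM/Stage4Interfaces.lean`; companion document
run/shared/lean/pub/hodge-director/STAGE4-ABELIAN-MOTIVIC-TYPE.md (v9, §12).
-/
import Summits.HodgeConjecture.CorCM.Stage4Interfaces
import Summits.HodgeConjecture.CorCM.Stage4StrictRoadDischarge
import Summits.HodgeConjecture.HodgeConjecture.Theorems.PadicSemiregularLiftHodgeAbelianVarietiesUnconditionalCorners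
import Literature.AlgebraicGeometry.HodgeTheory.DominatedByPowersHodgeConjecture
import Literature.AlgebraicGeometry.Motives.AbelianVarietyExistence
import Literature.AlgebraicGeometry.Surfaces.K3PeriodSurjectivityProofs
import HarnessLib

/-!
# Stage 4 — where the open content of the typed targets begins (degenerate slices are tree theorems)

The stage-4 targets `HC_K3Powers`, `HC_CubicFourfoldPowers` (and stage 3's `HC_AV`, consumed by the junctions)
quantify over ALL cartesian powers `X.pow m`, `m : ℕ` (resp. all abelian varieties), including slices that are
THEOREMS of the tree: `X.pow 0 = Spec ℂ` (dimension `0`, `hodgeConjectureFor_of_dim_zero`), `X.pow 1 ≅ X`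
(`HodgeTheory.hodgeConjectureFor_pow_one_iff`) with `X` a surface (the Hodge conjecture in dimension `≤ 3`,
`HodgeTheory.hodgeConjectureFor_of_dim_le_three_holds`: Lefschetz `(1,1)` + hard Lefschetz, Voisin II proof of
Prop. 10.26) or a cubic fourfold (Zucker 1977, the row-3 record), and abelian varieties of dimension `≤ 3`.
This file records, as kernel theorems:
* `hc_K3Powers_iff_forall_two_le` — `HC_K3Powers` is EQUIVALENT to its restriction to the powers `S^{m+2}`
  (dimension `≥ 4`): the companion document's «OPEN for `m ≥ 2`» (Varesco 2023 §0.1) is kernel-exact, the slices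
  `m = 0, 1` being `hc_K3Powers_pow_zero` / `hc_K3Powers_pow_one`;
* `hc_K3Pairs_self_of_hc_K3Powers` — the diagonal part of `HC_K3Pairs` (`S × S`) is the slice `m = 2` of
  `HC_K3Powers` (transport along `(Spec ℂ ⊗ S) ⊗ S ≅ S ⊗ S`);
* `hc_cubicFourfoldPowers_iff_forall_two_le` — GIVEN the row-3 record (Zucker 1977, `hodgeTwoTwo_algebraic_cubicFourfold`),
  `HC_CubicFourfoldPowers` is equivalent to its restriction to `X^{m+2}` (dimension `≥ 8`);
* `hc_av_iff_forall_four_le` — `HC_AV` is equivalent to the Hodge conjecture for abelian varieties of dimension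
  `≥ 4` (dimension `≤ 3` is the tree theorem `hodgeAbelianVarieties_dim_le_three_discharged` of
  `Theorems/PadicSemiregularLiftHodgeAbelianVarietiesUnconditionalCorners`, reused by name);
* non-vacuity of the carriers the targets quantify over, as far as the tree certifies it: André's base pieces
  (`Andre1996.IsAbelianTypePiece`, the carrier of road (R1)) are inhabited in every dimension OUTRIGHT
  (`exists_isAbelianTypePiece`, from `Motives.exists_abelianVariety_dim_eq_succ`); projective K3 surfaces
  (`Surfaces.IsK3Surface`, rows 1–2) are inhabited MODULO the Literature record of the surjectivity of the period
  map (`Surfaces.Huybrechts_K3_periodSurjective_projective`, via its proved corollary `exists_isK3Surface`) — the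
  tree constructs no K3 surface outright, so every row-1/2 statement is, in the kernel, relative to that record's
  witnesses (`exists_isK3Surface_and_hc_pow_le_one`).
The targets with a built-in `2 ≤ n` (`HC_K3HilbertType`, `HC_KummerType`: dimension `2n ≥ 4`) have no theorem slice.
Nothing here is asserted about the open slices. [cite: Varesco2023, §0.1–0.2] [cite: VoisinHodgeII2003, §10.2.3]
-/

noncomputable section

open CategoryTheory MonoidalCategory
open Literature.AlgebraicGeometry
open Literature.AlgebraicGeometry.Motives (SchemeOver IsSmoothProjective AbelianVariety)
open Literature.AlgebraicGeometry.HodgeTheory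
open Literature.AlgebraicGeometry.Surfaces (IsK3Surface)

namespace Summit.HodgeConjecture.CorCM.Stage4

/-! ## Row 1a — `HC_K3Powers`: slices `m = 0, 1` are theorems; the open content is `m ≥ 2` -/

/-- Slice `m = 0` of `HC_K3Powers`: `S⁰ = Spec ℂ` (dimension `0`) satisfies the Hodge conjecture — a tree theorem
(`hodgeConjectureFor_of_dim_zero`). [cite: VoisinHodgeI2002, §11.3] -/
theorem hc_K3Powers_pow_zero {S : SchemeOver ℂ} (hS : IsK3Surface S) : HodgeConjectureFor (0 * 2) (S.pow 0) :=
  hodgeConjectureFor_of_dim_zero (by simpa using hS.isSmoothProjective.pow 0)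

/-- Slice `m = 1` of `HC_K3Powers`: `S¹ = Spec ℂ ⊗ S` is a smooth projective surface, for which the Hodge conjecture
is a tree theorem (dimension `≤ 3`: Lefschetz `(1,1)` and hard Lefschetz, `hodgeConjectureFor_of_dim_le_three_holds`).
[cite: VoisinHodgeII2003, §10.2.3 proof of Prop. 10.26] [cite: VoisinHodgeI2002, Thm. 11.30] -/
theorem hc_K3Powers_pow_one {S : SchemeOver ℂ} (hS : IsK3Surface S) : HodgeConjectureFor (1 * 2) (S.pow 1) :=
  hodgeConjectureFor_of_dim_le_three_holds (by norm_num) (hS.isSmoothProjective.pow 1)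

/-- The Hodge conjecture for the K3 surface itself (dimension `2`) is a tree theorem. [cite: VoisinHodgeI2002, Thm. 11.30] -/
theorem hc_K3 {S : SchemeOver ℂ} (hS : IsK3Surface S) : HodgeConjectureFor 2 S :=
  hodgeConjectureFor_of_dim_le_three_holds (by norm_num) hS.isSmoothProjective

/-- **`HC_K3Powers` is equivalent to its restriction to the powers `S^{m+2}` (dimension `2(m+2) ≥ 4`)**: the slices
`m = 0, 1` are theorems, so the open content of the row-1a target begins at `S × S` — the companion document's
«OPEN for `m ≥ 2`» in kernel form. [cite: Varesco2023, §0.1–0.2] -/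
theorem hc_K3Powers_iff_forall_two_le :
    HC_K3Powers ↔ ∀ ⦃S : SchemeOver ℂ⦄, IsK3Surface S → ∀ m : ℕ, HodgeConjectureFor ((m + 2) * 2) (S.pow (m + 2)) := by
  refine ⟨fun h S hS m ↦ h hS (m + 2), fun h S hS m ↦ ?_⟩
  match m with
  | 0 => exact hc_K3Powers_pow_zero hS
  | 1 => exact hc_K3Powers_pow_one hS
  | m + 2 => exact h hS m

/-- **The diagonal part of `HC_K3Pairs` is the slice `m = 2` of `HC_K3Powers`**: the Hodge conjecture for all powers
of K3 surfaces gives it for every self-product `S × S` (transport along `S² = (Spec ℂ ⊗ S) ⊗ S ≅ S ⊗ S`, the left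
unitor whiskered, `HodgeTheory.hodgeConjectureFor_iff_of_iso'`).  (The converse «square ⟹ all powers» is in print
only for a CM endomorphism field: `CorCM/Stage4RowOnePowersOfSquare`, Varesco 2025 Thm. 2.2 / Rem. 2.17.)
[cite: Varesco2023, §0.2] [cite: Varesco2025, Thm. 2.2 and Rem. 2.17] -/
theorem hc_K3Pairs_self_of_hc_K3Powers (h : HC_K3Powers) {S : SchemeOver ℂ} (hS : IsK3Surface S) :
    HodgeConjectureFor 4 (S ⊗ S) :=
  (hodgeConjectureFor_iff_of_iso' (show S.pow 2 ≅ S ⊗ S from whiskerRightIso (λ_ S) S)).1 (h hS 2)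

/-- Per-surface form: for ONE K3 surface `S`, «HC for all powers of `S`» is equivalent to «HC for the powers `S^{m+2}`».
[cite: Varesco2023, §0.1–0.2] -/
theorem forall_hc_K3_pow_iff_forall_two_le {S : SchemeOver ℂ} (hS : IsK3Surface S) :
    (∀ m : ℕ, HodgeConjectureFor (m * 2) (S.pow m)) ↔ ∀ m : ℕ, HodgeConjectureFor ((m + 2) * 2) (S.pow (m + 2)) := by
  refine ⟨fun h m ↦ h (m + 2), fun h m ↦ ?_⟩
  match m with
  | 0 => exact hc_K3Powers_pow_zero hS
  | 1 => exact hc_K3Powers_pow_one hS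
  | m + 2 => exact h m

/-! ## Row 3b — `HC_CubicFourfoldPowers`: slice `m = 0` is a theorem, `m = 1` is Zucker's record; open content `m ≥ 2` -/

/-- Slice `m = 0` of `HC_CubicFourfoldPowers` (dimension `0`). [cite: VoisinHodgeI2002, §11.3] -/
theorem hc_cubicFourfoldPowers_pow_zero {X : SchemeOver ℂ} (hX : Motives.IsSmoothHypersurface 4 3 X) :
    HodgeConjectureFor (0 * 4) (X.pow 0) :=
  hodgeConjectureFor_of_dim_zero (by simpa using hX.1.pow 0)

/-- Slice `m = 1` of `HC_CubicFourfoldPowers` is the Hodge conjecture for the cubic fourfold itself — Zucker 1977, BY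
NAME the row-3 record (`hc_cubicFourfold`), transported along `X¹ ≅ X`. [cite: Zucker1977, (3.2) Theorem, p. 206] -/
theorem hc_cubicFourfoldPowers_pow_one (h : hodgeTwoTwo_algebraic_cubicFourfold) {X : SchemeOver ℂ}
    (hX : Motives.IsSmoothHypersurface 4 3 X) : HodgeConjectureFor (1 * 4) (X.pow 1) :=
  (hodgeConjectureFor_pow_one_iff X).2 (hc_cubicFourfold h hX)

/-- **Given Zucker's theorem (the row-3 record), `HC_CubicFourfoldPowers` is equivalent to its restriction to the
powers `X^{m+2}` (dimension `4(m+2) ≥ 8`)** — the open content of the row-3b target begins at `X × X`.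
[cite: Zucker1977, (3.2) Theorem, p. 206] [cite: Andre1996Motifs, Thm. 7.2 (p. 35)] -/
theorem hc_cubicFourfoldPowers_iff_forall_two_le (h : hodgeTwoTwo_algebraic_cubicFourfold) :
    HC_CubicFourfoldPowers ↔
      ∀ ⦃X : SchemeOver ℂ⦄, Motives.IsSmoothHypersurface 4 3 X → ∀ m : ℕ, HodgeConjectureFor ((m + 2) * 4) (X.pow (m + 2)) := by
  refine ⟨fun hP X hX m ↦ hP hX (m + 2), fun hP X hX m ↦ ?_⟩
  match m with
  | 0 => exact hc_cubicFourfoldPowers_pow_zero hX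
  | 1 => exact hc_cubicFourfoldPowers_pow_one h hX
  | m + 2 => exact hP hX m

/-- Without any record: `HC_CubicFourfoldPowers` is equivalent to «Zucker's slice `m = 1` and the powers `X^{m+2}`».
[cite: Zucker1977, (3.2) Theorem, p. 206] -/
theorem hc_cubicFourfoldPowers_iff_pow_one_and_forall_two_le :
    HC_CubicFourfoldPowers ↔
      (∀ ⦃X : SchemeOver ℂ⦄, Motives.IsSmoothHypersurface 4 3 X → HodgeConjectureFor 4 X) ∧
        ∀ ⦃X : SchemeOver ℂ⦄, Motives.IsSmoothHypersurface 4 3 X → ∀ m : ℕ, HodgeConjectureFor ((m + 2) * 4) (X.pow (m + 2)) := by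
  refine ⟨fun hP ↦ ⟨fun X hX ↦ (hodgeConjectureFor_pow_one_iff X).1 (hP hX 1), fun X hX m ↦ hP hX (m + 2)⟩,
    fun ⟨h1, hP⟩ X hX m ↦ ?_⟩
  match m with
  | 0 => exact hc_cubicFourfoldPowers_pow_zero hX
  | 1 => exact (hodgeConjectureFor_pow_one_iff X).2 (h1 hX)
  | m + 2 => exact hP hX m

/-! ## Stage 3's conclusion `HC_AV` as consumed here: dimension `≤ 3` is a theorem; open content is dimension `≥ 4` -/

/-- **`HC_AV` is equivalent to the Hodge conjecture for complex abelian varieties of dimension `≥ 4`**: dimension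
`≤ 3` is the tree theorem `Theorems.HodgeAbelianVarieties.Unconditional.hodgeAbelianVarieties_dim_le_three_discharged`
(Lefschetz `(1,1)` + hard Lefschetz, Voisin II proof of Prop. 10.26), reused BY NAME.
[cite: VoisinHodgeII2003, §10.2.3 proof of Prop. 10.26] [cite: Deligne2000, §1] -/
theorem hc_av_iff_forall_four_le : HC_AV ↔ ∀ A : AbelianVariety ℂ, 4 ≤ A.dim → HodgeConjectureFor A.dim A.X := by
  refine ⟨fun h A _ ↦ hc_av_iff.mp h A, fun h ↦ hc_av_iff.mpr fun A ↦ ?_⟩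
  by_cases hA : A.dim ≤ 3
  · exact Summit.HodgeConjecture.HodgeConjecture.Theorems.HodgeAbelianVarieties.Unconditional.hodgeAbelianVarieties_dim_le_three_discharged
      A hA
  · exact h A (by omega)

/-! ## Non-vacuity of the carriers, as far as the tree certifies it -/

/-- André's base pieces (the carrier of road (R1), `Andre1996.IsAbelianTypePiece`) exist in every dimension,
OUTRIGHT: `Spec ℂ` in dimension `0` and an abelian variety of dimension `d + 1` (powers of an elliptic curve,
`Motives.exists_abelianVariety_dim_eq_succ`). [cite: Andre1996Motifs, §4.5 (p. 24)] [cite: SilvermanAEC2009, III.3.6] -/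
theorem exists_isAbelianTypePiece (d : ℕ) : ∃ X : SchemeOver ℂ, Andre1996.IsAbelianTypePiece d X := by
  match d with
  | 0 => exact ⟨_, Andre1996.IsAbelianTypePiece.unit⟩
  | d + 1 =>
    obtain ⟨A, hA⟩ := Motives.exists_abelianVariety_dim_eq_succ ℂ d
    exact ⟨A.X, hA ▸ Andre1996.IsAbelianTypePiece.abelianVariety A⟩

/-- The abelian-variety binder of `HC_AV` is inhabited in every dimension `≥ 4` (where the open content lies), OUTRIGHT.
[cite: SilvermanAEC2009, III.3.6] -/
theorem exists_abelianVariety_four_le_dim : ∃ A : AbelianVariety ℂ, 4 ≤ A.dim := by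
  obtain ⟨A, hA⟩ := Motives.exists_abelianVariety_dim_eq_succ ℂ 3
  exact ⟨A, by omega⟩

/-- Projective K3 surfaces — the carrier `Surfaces.IsK3Surface` of rows 1–2 — are inhabited MODULO the Literature record
of the surjectivity of the period map for projective K3 surfaces (`Surfaces.Huybrechts_K3_periodSurjective_projective`,
Huybrechts Ch. 6 Rem. 3.3 / Ch. 7; its corollary `exists_isK3Surface` is proved in the tree); and for every such
witness the slices `m ≤ 1` of the row-1a target hold.  The tree constructs no K3 surface outright.
[cite: Huybrechts2016K3, Ch. 6 Rem. 3.3] -/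
theorem exists_isK3Surface_and_hc_pow_le_one (h : Surfaces.Huybrechts_K3_periodSurjective_projective) :
    ∃ S : SchemeOver ℂ, IsK3Surface S ∧ HodgeConjectureFor 2 S ∧
      HodgeConjectureFor (0 * 2) (S.pow 0) ∧ HodgeConjectureFor (1 * 2) (S.pow 1) := by
  obtain ⟨S, hS⟩ := h.exists_isK3Surface
  exact ⟨S, hS, hc_K3 hS, hc_K3Powers_pow_zero hS, hc_K3Powers_pow_one hS⟩


/-! ## Appended (literature seat `hodge-director-lit-stage4`, gen 11, 2026-08-21): row 2b — the open content of
`HC_KummerType`, MODULO its CITE records, is `n ≥ 4` and lies OUTSIDE the subalgebra generated by `H²`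

Companion document v11 (§14).  `HC_KummerType` (`Stage4Interfaces.lean`, built-in `2 ≤ n`) has no OUTRIGHT theorem
slice, but two CITE-record slices: `n = 2` (Floccari–Varesco 2024 Cor. 1.2, record
`Hyperkaehler.FloccariVaresco2024_hodgeClasses_algebraic_kum2Type`, wiring `hc_kum2Type`) and `n = 3` (Floccari 2023
Thm. 1.1, record `Hyperkaehler.Floccari2023_hodgeClasses_algebraic_kum3Type`, wiring `hc_kum3Type`).  GIVEN those two
records the target is equivalent in the kernel to its slice `n ≥ 4` (`hc_kummerType_iff_forall_four_le`); GIVEN in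
addition Floccari–Varesco 2024 Thm. 1.1 (record `Hyperkaehler.FloccariVaresco2024_degreeTwoGenerated_hodgeClasses_algebraic`:
for every `n ≥ 2`, rational `(j, j)`-classes in `A₂^{2j}(X)`, the tree's `Hyperkaehler.degreeTwoGenerated X j`, are
algebraic) it is equivalent to the algebraicity, for `n ≥ 4`, of the rational `(j, j)`-classes NOT in
`degreeTwoGenerated X j` (`hc_kummerType_iff_forall_four_le_of_not_mem_degreeTwoGenerated`) — the printed caveat
"However, Theorem 1.1 is not sufficient to prove the Hodge conjecture for `X` (see [GKLW19])" (Floccari–Varesco 2024,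
§1, after Thm. 1.1) made kernel-exact: by Verbitsky (loc. cit.: "`A₂^{2j}(X) ≅ Sym^j(H²(X, ℚ))` for `j ≤ n`")
`A₂•(X)` is the Verbitsky component of the Looijenga–Lunts–Verbitsky decomposition, and the other components are listed
for `Kumⁿ`, small `n`, in Green–Kim–Laza–Weyman (arXiv:1906.03432, §3).  The Hodge-model conjunct of
`HodgeConjectureFor` is the tree theorem `nonempty_hodgeModel_holds`.  Nothing is asserted about the open slice.
[cite: FloccariVaresco2024, Thm. 1.1 and Cor. 1.2 (§1)] [cite: Floccari2023, Thm. 1.1 (§1)]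
-/

/-- Slice `n = 2` of `HC_KummerType` in the target's own spelling `2 * 2`: Floccari–Varesco 2024 Cor. 1.2 BY NAME
(`hc_kum2Type`). [cite: FloccariVaresco2024, Cor. 1.2 (§1)] -/
theorem hc_kummerType_two (h2 : Hyperkaehler.FloccariVaresco2024_hodgeClasses_algebraic_kum2Type) {X : SchemeOver ℂ}
    (hX : IsSmoothProjective (2 * 2) X) (hK : Hyperkaehler.IsOfGeneralizedKummerType 2 X) :
    HodgeConjectureFor (2 * 2) X :=
  hc_kum2Type h2 hX hK

/-- Slice `n = 3` of `HC_KummerType` in the target's own spelling `2 * 3`: Floccari 2023 Thm. 1.1 BY NAME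
(`hc_kum3Type`). [cite: Floccari2023, Thm. 1.1 (§1)] -/
theorem hc_kummerType_three (h3 : Hyperkaehler.Floccari2023_hodgeClasses_algebraic_kum3Type) {X : SchemeOver ℂ}
    (hX : IsSmoothProjective (2 * 3) X) (hK : Hyperkaehler.IsOfGeneralizedKummerType 3 X) :
    HodgeConjectureFor (2 * 3) X :=
  hc_kum3Type h3 hX hK

/-- **GIVEN the two CITE records (`Kum²`: Floccari–Varesco 2024 Cor. 1.2; `Kum³`: Floccari 2023 Thm. 1.1), the
row-2b target `HC_KummerType` is equivalent to its slice `n ≥ 4`** (dimension `2n ≥ 8`) — the companion document's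
«OPEN for `n ≥ 4`» is kernel-exact modulo those records. [cite: FloccariVaresco2024, Cor. 1.2 (§1)]
[cite: Floccari2023, Thm. 1.1 (§1)] -/
theorem hc_kummerType_iff_forall_four_le (h2 : Hyperkaehler.FloccariVaresco2024_hodgeClasses_algebraic_kum2Type)
    (h3 : Hyperkaehler.Floccari2023_hodgeClasses_algebraic_kum3Type) :
    HC_KummerType ↔ ∀ (n : ℕ), 4 ≤ n → ∀ ⦃X : SchemeOver ℂ⦄, IsSmoothProjective (2 * n) X →
      Hyperkaehler.IsOfGeneralizedKummerType n X → HodgeConjectureFor (2 * n) X := by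
  refine ⟨fun h n hn X hX hK ↦ h n (by omega) hX hK, fun h n hn X hX hK ↦ ?_⟩
  rcases Nat.lt_or_ge n 4 with hlt | h4
  · obtain rfl | rfl : n = 2 ∨ n = 3 := by omega
    · exact hc_kummerType_two h2 hX hK
    · exact hc_kummerType_three h3 hX hK
  · exact h n h4 hX hK

/-- Per variety, every `n ≥ 2`: GIVEN Floccari–Varesco 2024 Thm. 1.1 BY NAME, the Hodge conjecture for a smooth
projective `Kumⁿ`-type `X` REDUCES to the rational `(j, j)`-classes outside `A₂^{2j}(X) ⊗ ℂ`
(`Hyperkaehler.degreeTwoGenerated X j`); the Hodge-model conjunct is the tree theorem `nonempty_hodgeModel_holds`.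
[cite: FloccariVaresco2024, Thm. 1.1 (§1)] -/
theorem hodgeConjectureFor_kummerType_of_not_mem_degreeTwoGenerated
    (h11 : Hyperkaehler.FloccariVaresco2024_degreeTwoGenerated_hodgeClasses_algebraic) {n : ℕ} (hn : 2 ≤ n)
    {X : SchemeOver ℂ} (hX : IsSmoothProjective (2 * n) X) (hK : Hyperkaehler.IsOfGeneralizedKummerType n X)
    (h : ∀ (j : ℕ) (c : complexBetti X (2 * j)), IsRationalClass c → IsOfHodgeType (2 * n) X (2 * j) j j c →
      c ∉ Hyperkaehler.degreeTwoGenerated X j → c ∈ algebraicClasses X j) :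
    HodgeConjectureFor (2 * n) X := by
  refine ⟨nonempty_hodgeModel_holds hX, fun j c hc hjj ↦ ?_⟩
  by_cases hA : c ∈ Hyperkaehler.degreeTwoGenerated X j
  · exact h11 n hn hX hK j c hc hjj hA
  · exact h j c hc hjj hA

/-- **GIVEN the three CITE records of row 2b (Floccari–Varesco 2024 Thm. 1.1 and Cor. 1.2; Floccari 2023 Thm. 1.1),
`HC_KummerType` is equivalent to: for every `n ≥ 4` and every smooth projective `Kumⁿ`-type `X`, every rational
`(j, j)`-class NOT in the subalgebra generated by `H²` is algebraic** — the printed caveat "However, Theorem 1.1 is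
not sufficient to prove the Hodge conjecture for `X` (see [GKLW19])" (Floccari–Varesco 2024 §1) delimited in the
kernel: the open content of row 2b is exactly these classes (the non-Verbitsky Looijenga–Lunts–Verbitsky components,
`n ≥ 4`). [cite: FloccariVaresco2024, Thm. 1.1 and Cor. 1.2 (§1)] [cite: Floccari2023, Thm. 1.1 (§1)] -/
theorem hc_kummerType_iff_forall_four_le_of_not_mem_degreeTwoGenerated
    (h2 : Hyperkaehler.FloccariVaresco2024_hodgeClasses_algebraic_kum2Type)
    (h3 : Hyperkaehler.Floccari2023_hodgeClasses_algebraic_kum3Type)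
    (h11 : Hyperkaehler.FloccariVaresco2024_degreeTwoGenerated_hodgeClasses_algebraic) :
    HC_KummerType ↔ ∀ (n : ℕ), 4 ≤ n → ∀ ⦃X : SchemeOver ℂ⦄, IsSmoothProjective (2 * n) X →
      Hyperkaehler.IsOfGeneralizedKummerType n X → ∀ (j : ℕ) (c : complexBetti X (2 * j)), IsRationalClass c →
        IsOfHodgeType (2 * n) X (2 * j) j j c → c ∉ Hyperkaehler.degreeTwoGenerated X j → c ∈ algebraicClasses X j := by
  rw [hc_kummerType_iff_forall_four_le h2 h3]
  refine ⟨fun h n hn X hX hK j c hc hjj _ ↦ (hodgeConjectureFor_iff.mp (h n hn hX hK)).2 j c hc hjj,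
    fun h n hn X hX hK ↦ ?_⟩
  exact hodgeConjectureFor_kummerType_of_not_mem_degreeTwoGenerated h11 (by omega) hX hK (h n hn hX hK)

end Summit.HodgeConjecture.CorCM.Stage4

end
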